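import Mathlib
import Summits.KontsevichZagierPeriods.KontsevichZagierPeriods.Theorems.SoloInformedHoffmanChart
import Summits.KontsevichZagierPeriods.KontsevichZagierPeriods.Theorems.SoloInformedHoffmanWord
import HarnessLib
import HarnessLib.Audit

/-!
# SoloInformed — Hoffman's relation: the pieces of the garland (file 4)

Solo programme `solo-KontsevichZagierPeriods-informed`, session s48 (PROGRAMME L). Dimension
`n = m + 2`, `u` admissible of weight `m + 1` with word `ε`.

The linear extensions `σ` of the garland poset `E` (chain `t₀ > ⋯ > t_m`, pendant `t_{m+1} < t₀`)
are in bijection with the SLOT `s ∈ {1, …, m+1}` of the pendant in the total order; the chain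
coordinate `i` then sits at slot `succAbove s i`.  The simplex piece of `σ` is the word integral
of the word `ε` with the letter `1` INSERTED at slot `s`:

  `⟦(G|_{C_σ}) ∘ cellPerm σ⟧ = mzvClass (idx_s)`, `idx_s = ofBinaryWord ((binaryWord u).insertIdx s 1)`
(`SoloInformedHoffmanWord`).  §0 first finishes the chart: the pull-back identity `A = g ∘ λ · |det J_λ|`
(from `soloInformed_word_mul` and THE BRIDGE `F_ε = G(Q)`), the garland representation `G`, MOVE A
`[A] − [G] ∈ relations` (rule (2)) and the order-cell dissection of `G` (engine THM XXXVIII); summing,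

  `⟦A⟧ = Σ_{s=1}^{m+1} mzvClass (idx_s)`   (`soloInformed_hof_repA_class`),

the INTEGRAL side of Kaneko–Yamamoto's identity for `((1), u)` in `𝒫`.  (Port of
`SoloInformedSumPieces` §4–7 from the depth-2 word to a general word.)

References: S. Yamamoto, arXiv:1405.6499; M. Kaneko, S. Yamamoto, arXiv:1605.03117 §4;
R. Stanley 1986 (order polytopes); Kontsevich–Zagier 2001 §1.2.
-/

noncomputable section

open MeasureTheory Set MvPolynomial
open Literature.ModelTheory.ExponentialFields Literature.NumberTheory.Transcendental
open Literature.NumberTheory.Transcendental.KZ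

namespace Summit.KontsevichZagierPeriods.KontsevichZagierPeriods.Theorems

variable {m : ℕ}

/-! ## 0. The pull-back identity and the garland representation -/

section pullback

variable {u : List ℕ} {k : ℕ} (hu : MZV.IsAdmissible u) (hw : MZV.weight u = m + 1)
  (hk : u.length = k + 1)
include hu hw hk

/-- The `u`-prefix product `Q_r` is the prefix product of `Fin.init x` at `J_{r+1} − 1`. -/
theorem soloInformed_QU_eq_PP_init (x : Fin (m + 2) → ℝ) {r : ℕ} (hr : r ≤ k) :
    soloInformedQU (m + 1) u x r = soloInformedPP (Fin.init x) ((soloInformedEnds u).getD r 0 - 1) := by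
  have h1 := soloInformed_one_le_ends_getD hu.1 (show r < u.length by omega)
  have h2 := soloInformed_ends_getD_le_weight hu.1 hw hk r
  unfold soloInformedQU soloInformedPP
  have h : Finset.univ.filter (fun l : Fin (m + 1 + 1) => l.1 < (soloInformedEnds u).getD r 0) =
      (Finset.univ.filter (fun i : Fin (m + 1) => i.1 ≤ (soloInformedEnds u).getD r 0 - 1)).map
        Fin.castSuccEmb := by
    ext l
    simp only [Finset.mem_filter, Finset.mem_univ, true_and, Finset.mem_map, Fin.castSuccEmb_apply]
    constructor
    · intro hl
      exact ⟨⟨l, by omega⟩, by simp only; omega, Fin.ext rfl⟩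
    · rintro ⟨i, hi, rfl⟩
      simp only [Fin.val_castSucc]
      omega
  rw [h, Finset.prod_map]
  rfl

/-- **The pull-back identity** `A(x) = g(λ x) · |det J_λ(x)|` on the cube. -/
theorem soloInformed_hofG_lam {x : Fin (m + 2) → ℝ} (hx : x ∈ soloInformedOpenCube (m + 2)) :
    (soloInformedHofDatum hu hw hk).repA.integrand x =
      soloInformedHofG u m (soloInformedHofLam m x) *
        |(soloInformedJacCLM (soloInformedHofLamPoly m) x).det| := by
  have hD := soloInformed_det_hofLam_pos hx
  have hinit : Fin.init x ∈ soloInformedOpenCube (m + 1) := fun j => hx (Fin.castSucc j)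
  -- `G(Q) = F_ε(init x)`
  have hGQ : soloInformedGQ (List.ofFn fun t : Fin (k + 1) => soloInformedQU (m + 1) u x t) =
      soloInformedCubeWf (soloInformedWordFn u m) (Fin.init x) := by
    rw [soloInformed_cubeWf_eq_GQ hu.1 hw hk]
    congr 1
    exact List.ofFn_inj.2 (funext fun r => soloInformed_QU_eq_PP_init hu hw hk x (by omega))
  -- `F_ε(init x) · 1 = (∏ ω_ε(P_k)) · ∏_{i<m} P_i`
  have hmul := soloInformed_word_mul (soloInformedWordFn u m) (soloInformed_wordFn_last hu hw)
    (fun j => soloInformedPrefixProd (Fin.init x) j) fun j => (soloInformed_prefixProd_pos hinit j).ne'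
  rw [soloInformed_hofDatum_repA_integrand, hGQ, soloInformedCubeWf, ← hmul, abs_of_pos hD,
    soloInformed_det_hofLam, soloInformedHofG_eq]
  simp only [soloInformedHofLam_castSucc, soloInformedHofLam_last, soloInformed_prefixProd_init]
  ring

omit hu hw hk in
/-- The domain of `A` is measurable. -/
theorem soloInformed_measurableSet_hofDA :
    MeasurableSet (soloInformedOpenCube (m + 2) ∩ {x | x (Fin.last (m + 1)) < x 0}) :=
  (soloInformed_measurableSet_openCube _).inter
    (measurableSet_lt (measurable_pi_apply _) (measurable_pi_apply _))

/-- Integrability of `g` on `𝒢` (transport of `A` along `λ`). -/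
theorem soloInformed_integrableOn_hofG :
    IntegrableOn (soloInformedHofG u m) (soloInformedHofGarland m) := by
  rw [← soloInformed_image_hofLam, soloInformedHofLam, soloInformed_integrableOn_image_polyMap_iff _
    (soloInformed_measurableSet_hofDA (m := m)) (soloInformed_injOn_hofLam.mono inter_subset_left)]
  have h := (soloInformedHofDatum hu hw hk).repA.integrableOn
  rw [soloInformed_hofDatum_repA_domain] at h
  refine h.congr_fun (fun x hx => ?_) soloInformed_measurableSet_hofDA
  rw [soloInformed_hofG_lam hu hw hk hx.1, mul_comm]
  rfl

/-- **The garland representation `G = [𝒢, g]`** of the index `u`. -/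
def soloInformedHofGRep : IntegralRep (m + 2) where
  domain := soloInformedHofGarland m
  integrand := soloInformedHofG u m
  isSemialgebraic_domain := soloInformed_isSemialgebraic_hofGarland
  isSemialgebraicFunOn_integrand :=
    soloInformed_isSemialgebraicFunOn_quot soloInformed_isSemialgebraic_hofGarland 1
      (soloInformedHofDen u m) _ (fun t ht => (soloInformed_hofDen_pos u ht.1).ne')
      fun t _ => by rw [soloInformedHofG_eq_div, map_one]
  integrableOn := soloInformed_integrableOn_hofG hu hw hk

/-- Auxiliary (Hoffman chart): `soloInformedHofGRep_domain`. -/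
@[simp] theorem soloInformedHofGRep_domain :
    (soloInformedHofGRep hu hw hk).domain = soloInformedHofGarland m := rfl

/-- Auxiliary (Hoffman chart): `soloInformedHofGRep_integrand`. -/
@[simp] theorem soloInformedHofGRep_integrand :
    (soloInformedHofGRep hu hw hk).integrand = soloInformedHofG u m := rfl

/-- **MOVE A (rule (2) along `λ`)**: `[A] − [G] ∈ relations`. -/
theorem soloInformed_hof_moveA :
    of (soloInformedHofDatum hu hw hk).repA - of (soloInformedHofGRep hu hw hk) ∈ relations := by
  refine soloInformed_of_sub_of_mem_relations_polyMapCLM (soloInformedHofLamPoly m)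
    (soloInformedHofDatum hu hw hk).repA (soloInformedHofGRep hu hw hk) ?_ ?_ fun x hx => ?_
  · rw [soloInformed_hofDatum_repA_domain]; exact soloInformed_injOn_hofLam.mono inter_subset_left
  · rw [soloInformed_hofDatum_repA_domain]; exact soloInformed_image_hofLam.symm
  · rw [soloInformed_hofDatum_repA_domain] at hx
    exact soloInformed_hofG_lam hu hw hk hx.1

/-- **`[G] − ∑_{σ ⊨ E} [G|_{C_σ}] ∈ relations`** (engine THM XXXVIII). -/
theorem soloInformed_hofG_dissect :
    of (soloInformedHofGRep hu hw hk) -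
      ∑ σ ∈ Finset.univ.filter (soloInformedCompat (soloInformedHofPoset m)),
        of (soloInformedCellRep (soloInformedHofGRep hu hw hk) σ) ∈ relations :=
  soloInformed_of_sub_sum_linext _ (soloInformedHofPoset m) inter_subset_right _
    fun _ hσ => Finset.mem_filter.2 ⟨Finset.mem_univ _, hσ⟩

end pullback

/-! ## 1. Linear extensions of the garland: the slot of the pendant determines everything -/

/-- On the chain the coordinate-to-slot map of a compatible `σ` is strictly increasing. -/
theorem soloInformed_hofCompat_strictMono {σ : Equiv.Perm (Fin (m + 2))}
    (hσ : soloInformedCompat (soloInformedHofPoset m) σ) :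
    StrictMono (fun i : Fin (m + 1) => soloInformedCellPerm σ (Fin.castSucc i)) := by
  refine Fin.strictMono_iff_lt_succ.2 fun j => ?_
  have h := hσ (Fin.castSucc j.succ, Fin.castSucc (Fin.castSucc j))
    (List.mem_append_left _ (List.mem_map.2 ⟨j, List.mem_finRange j, rfl⟩))
  exact Fin.rev_lt_rev.2 h

/-- The pendant sits strictly below the top coordinate `0`. -/
theorem soloInformed_hofCompat_pendant {σ : Equiv.Perm (Fin (m + 2))}
    (hσ : soloInformedCompat (soloInformedHofPoset m) σ) :
    soloInformedCellPerm σ 0 < soloInformedCellPerm σ (Fin.last (m + 1)) :=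
  Fin.rev_lt_rev.2 (hσ (Fin.last (m + 1), 0) (List.mem_append_right _ (List.mem_singleton_self _)))

/-- The slot of the pendant is not the top slot. -/
theorem soloInformed_hofCompat_slot_ne_zero {σ : Equiv.Perm (Fin (m + 2))}
    (hσ : soloInformedCompat (soloInformedHofPoset m) σ) :
    soloInformedCellPerm σ (Fin.last (m + 1)) ≠ 0 :=
  (lt_of_le_of_lt (Fin.zero_le _) (soloInformed_hofCompat_pendant hσ)).ne'

/-- **The chain coordinate `i` sits at slot `succAbove s i`**, `s` the slot of the pendant. -/
theorem soloInformed_hofCompat_cellPerm_castSucc {σ : Equiv.Perm (Fin (m + 2))}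
    (hσ : soloInformedCompat (soloInformedHofPoset m) σ) (i : Fin (m + 1)) :
    soloInformedCellPerm σ (Fin.castSucc i) =
      Fin.succAbove (soloInformedCellPerm σ (Fin.last (m + 1))) i :=
  congr_fun (soloInformed_strictMono_eq_succAbove (soloInformed_hofCompat_strictMono hσ)
    fun i h => (Fin.castSucc_lt_last i).ne ((soloInformedCellPerm σ).injective h)) i

/-! ## 2. The simplex piece of a linear extension is a multiple zeta value -/

section pieces

variable {u : List ℕ} {k : ℕ} (hu : MZV.IsAdmissible u) (hw : MZV.weight u = m + 1)
  (hk : u.length = k + 1)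

/-- The piece of a linear extension lives on the cube cell `(0,1)ⁿ ∩ C_σ`. -/
theorem soloInformed_hofCellRep_domain {σ : Equiv.Perm (Fin (m + 2))}
    (hσ : soloInformedCompat (soloInformedHofPoset m) σ) :
    (soloInformedCellRep (soloInformedHofGRep hu hw hk) σ).domain =
      soloInformedOpenCube (m + 2) ∩ soloInformedCell σ := by
  rw [soloInformedCellRep_domain, soloInformedHofGRep_domain, soloInformedHofGarland]
  exact soloInformed_inter_orderSet_inter_cell hσ _

/-- **The simplex piece of a linear extension lives on Kontsevich's simplex.** -/
theorem soloInformed_hofPiece_domain {σ : Equiv.Perm (Fin (m + 2))}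
    (hσ : soloInformedCompat (soloInformedHofPoset m) σ) :
    ((soloInformedCellRep (soloInformedHofGRep hu hw hk) σ).reindex (soloInformedCellPerm σ)).domain =
      openOrderedSimplex (m + 2) :=
  soloInformed_reindex_cubeCell_domain _ σ (soloInformed_hofCellRep_domain hu hw hk hσ)

include hu hw in
/-- The garland letters, read through the slot map of `σ`, are the letters of the piece. -/
theorem soloInformed_hofEps_eq_letters {σ : Equiv.Perm (Fin (m + 2))}
    (hσ : soloInformedCompat (soloInformedHofPoset m) σ) (i : Fin (m + 2)) :
    soloInformedHofEps u m i =
      soloInformedHofLetters u m (soloInformedCellPerm σ (Fin.last (m + 1))) (soloInformedCellPerm σ i) := by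
  rcases Fin.eq_castSucc_or_eq_last i with ⟨j, rfl⟩ | rfl
  · rw [soloInformedHofEps_castSucc, soloInformed_hofCompat_cellPerm_castSucc hσ,
      soloInformed_hofLetters_succAbove hu hw]
  · rw [soloInformedHofEps_last, soloInformed_hofLetters_self hu hw]

/-- **The integrand of the simplex piece of `σ`** is the word-product of the attached index. -/
theorem soloInformed_hofPiece_integrand {σ : Equiv.Perm (Fin (m + 2))}
    (hσ : soloInformedCompat (soloInformedHofPoset m) σ) (w : Fin (m + 2) → ℝ) :
    ((soloInformedCellRep (soloInformedHofGRep hu hw hk) σ).reindex (soloInformedCellPerm σ)).integrand w =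
      ∏ l : Fin (m + 2), mzvForm ((MZV.binaryWord
        (soloInformedHofIdx u (soloInformedCellPerm σ (Fin.last (m + 1))))).getD l false) (w l) := by
  show soloInformedHofG u m (fun i => w (soloInformedCellPerm σ i)) = _
  unfold soloInformedHofG
  simp only [soloInformed_hofIdx_getD hu hw]
  rw [← Equiv.prod_comp (soloInformedCellPerm σ) (fun l : Fin (m + 2) => mzvForm
    (soloInformedHofLetters u m (soloInformedCellPerm σ (Fin.last (m + 1))) l) (w l))]
  exact Finset.prod_congr rfl fun i _ => by rw [soloInformed_hofEps_eq_letters hu hw hσ i]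

/-- **Each simplex piece IS a multiple zeta class**: `⟦(G|_{C_σ}) ∘ cellPerm σ⟧ = mzvClass (idx s_σ)`. -/
theorem soloInformed_hofPiece_class {σ : Equiv.Perm (Fin (m + 2))}
    (hσ : soloInformedCompat (soloInformedHofPoset m) σ) :
    toFormalPeriod (of ((soloInformedCellRep (soloInformedHofGRep hu hw hk) σ).reindex
      (soloInformedCellPerm σ))) =
      mzvClass (soloInformedHofIdx u (soloInformedCellPerm σ (Fin.last (m + 1)))) :=
  soloInformed_toFormalPeriod_eq_mzvClass (soloInformed_hofIdx_admissible hu hw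
    (soloInformed_hofCompat_slot_ne_zero hσ)) (soloInformed_hofIdx_weight hu hw _) _
    (soloInformed_hofPiece_domain hu hw hk hσ) (soloInformed_hofPiece_integrand hu hw hk hσ)

/-- The cell piece itself has the same class (rule (2) along the sorting permutation). -/
theorem soloInformed_hofCellRep_class {σ : Equiv.Perm (Fin (m + 2))}
    (hσ : soloInformedCompat (soloInformedHofPoset m) σ) :
    toFormalPeriod (of (soloInformedCellRep (soloInformedHofGRep hu hw hk) σ)) =
      mzvClass (soloInformedHofIdx u (soloInformedCellPerm σ (Fin.last (m + 1)))) := by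
  rw [← soloInformed_hofPiece_class hu hw hk hσ, toFormalPeriod_eq_iff]
  exact of_sub_of_reindex_mem_relations _ _

end pieces

/-! ## 3. The bijection `σ ↔ s` between linear extensions and slots -/

/-- The slot permutation attached to `s`: `castSucc i ↦ succAbove s i`, `last ↦ s`. -/
def soloInformedHofSlotPerm (s : Fin (m + 2)) : Equiv.Perm (Fin (m + 2)) :=
  finSuccEquivLast.trans (finSuccEquiv' s).symm

/-- Auxiliary (Hoffman pieces): `soloInformed_hofSlotPerm_last`. -/
@[simp] theorem soloInformed_hofSlotPerm_last (s : Fin (m + 2)) :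
    soloInformedHofSlotPerm s (Fin.last (m + 1)) = s := by
  simp [soloInformedHofSlotPerm, finSuccEquivLast_last, finSuccEquiv'_symm_none]

/-- Auxiliary (Hoffman pieces): `soloInformed_hofSlotPerm_castSucc`. -/
@[simp] theorem soloInformed_hofSlotPerm_castSucc (s : Fin (m + 2)) (i : Fin (m + 1)) :
    soloInformedHofSlotPerm s (Fin.castSucc i) = Fin.succAbove s i := by
  simp [soloInformedHofSlotPerm, finSuccEquivLast_castSucc, finSuccEquiv'_symm_some]

/-- The linear extension attached to the slot `s` (as a cell label `σ`). -/
def soloInformedHofSigma (s : Fin (m + 2)) : Equiv.Perm (Fin (m + 2)) :=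
  Fin.revPerm.trans (soloInformedHofSlotPerm s).symm

/-- Its coordinate-to-slot map is the slot permutation. -/
theorem soloInformed_cellPerm_hofSigma (s : Fin (m + 2)) :
    soloInformedCellPerm (soloInformedHofSigma s) = soloInformedHofSlotPerm s := by
  refine Equiv.ext fun i => ?_
  simp [soloInformedCellPerm, soloInformedHofSigma]

/-- `σ_s` is a linear extension of the garland poset (for `s ≠ 0`). -/
theorem soloInformed_hofCompat_hofSigma {s : Fin (m + 2)} (hs : s ≠ 0) :
    soloInformedCompat (soloInformedHofPoset m) (soloInformedHofSigma s) := by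
  have key : ∀ a b : Fin (m + 2), soloInformedHofSlotPerm s b < soloInformedHofSlotPerm s a →
      (soloInformedHofSigma s).symm a < (soloInformedHofSigma s).symm b := fun a b h => by
    have e : ∀ x, (soloInformedHofSigma s).symm x = Fin.rev (soloInformedHofSlotPerm s x) := fun x => by
      simp [soloInformedHofSigma]
    rw [e, e]
    exact Fin.rev_lt_rev.2 h
  intro p hp
  rcases List.mem_append.1 hp with hp | hp
  · obtain ⟨j, -, rfl⟩ := List.mem_map.1 hp
    apply key
    simp only [soloInformed_hofSlotPerm_castSucc]
    exact Fin.strictMono_succAbove s (Fin.castSucc_lt_succ (i := j))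
  · rw [List.mem_singleton.1 hp]
    apply key
    have h0 : soloInformedHofSlotPerm s 0 = 0 := by
      simpa [Fin.succAbove_ne_zero_zero hs] using soloInformed_hofSlotPerm_castSucc s 0
    rw [h0, soloInformed_hofSlotPerm_last]
    exact Fin.pos_of_ne_zero hs

/-- **A linear extension is determined by the slot of its pendant**: `σ = σ_{s(σ)}`. -/
theorem soloInformed_hofCompat_eq_hofSigma {σ : Equiv.Perm (Fin (m + 2))}
    (hσ : soloInformedCompat (soloInformedHofPoset m) σ) :
    σ = soloInformedHofSigma (soloInformedCellPerm σ (Fin.last (m + 1))) := by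
  have h : soloInformedCellPerm σ = soloInformedHofSlotPerm (soloInformedCellPerm σ (Fin.last (m + 1))) := by
    refine Equiv.ext fun i => ?_
    rcases Fin.eq_castSucc_or_eq_last i with ⟨j, rfl⟩ | rfl
    · rw [soloInformed_hofSlotPerm_castSucc, soloInformed_hofCompat_cellPerm_castSucc hσ]
    · rw [soloInformed_hofSlotPerm_last]
  refine Equiv.ext fun i => ?_
  show σ i = (soloInformedHofSlotPerm _).symm (Fin.revPerm i)
  rw [Equiv.eq_symm_apply, ← h]
  simp [soloInformedCellPerm]

/-- **Re-indexing a sum over the linear extensions by the slot of the pendant.** -/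
theorem soloInformed_sum_hofCompat_eq {α : Type*} [AddCommMonoid α] (F : Fin (m + 2) → α) :
    ∑ σ ∈ Finset.univ.filter (soloInformedCompat (soloInformedHofPoset m)),
      F (soloInformedCellPerm σ (Fin.last (m + 1))) = ∑ s ∈ Finset.univ.erase (0 : Fin (m + 2)), F s := by
  refine Finset.sum_nbij' (fun σ => soloInformedCellPerm σ (Fin.last (m + 1)))
    (fun s => soloInformedHofSigma s) (fun σ hσ => ?_) (fun s hs => ?_) (fun σ hσ => ?_)
    (fun s hs => ?_) fun _ _ => rfl
  · exact Finset.mem_erase.2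
      ⟨soloInformed_hofCompat_slot_ne_zero (Finset.mem_filter.1 hσ).2, Finset.mem_univ _⟩
  · exact Finset.mem_filter.2
      ⟨Finset.mem_univ _, soloInformed_hofCompat_hofSigma (Finset.mem_erase.1 hs).1⟩
  · exact (soloInformed_hofCompat_eq_hofSigma (Finset.mem_filter.1 hσ).2).symm
  · simp [soloInformed_cellPerm_hofSigma]

/-! ## 4. The class of the integral side -/

section classes

variable {u : List ℕ} {k : ℕ} (hu : MZV.IsAdmissible u) (hw : MZV.weight u = m + 1)
  (hk : u.length = k + 1)

/-- **`⟦G⟧ = ∑_{s ≠ 0} mzvClass (idx_s)`.** -/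
theorem soloInformed_hofG_class : toFormalPeriod (of (soloInformedHofGRep hu hw hk)) =
    ∑ s ∈ Finset.univ.erase (0 : Fin (m + 2)), mzvClass (soloInformedHofIdx u s) := by
  rw [← soloInformed_sum_hofCompat_eq (fun s => mzvClass (soloInformedHofIdx u s)),
    toFormalPeriod_eq_iff.2 (soloInformed_hofG_dissect hu hw hk), map_sum]
  exact Finset.sum_congr rfl fun σ hσ => soloInformed_hofCellRep_class hu hw hk (Finset.mem_filter.1 hσ).2

/-- **`⟦A⟧ = ∑_{s=1}^{m+1} mzvClass (idx_s)`**: the integral side of the Hoffman scale step is the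
sum over the slots of the word of `u` with `1` inserted, in the formal period ring. -/
theorem soloInformed_hof_repA_class : toFormalPeriod (of (soloInformedHofDatum hu hw hk).repA) =
    ∑ s ∈ Finset.univ.erase (0 : Fin (m + 2)), mzvClass (soloInformedHofIdx u s) := by
  rw [← soloInformed_hofG_class hu hw hk, toFormalPeriod_eq_iff]
  exact soloInformed_hof_moveA hu hw hk

end classes

end Summit.KontsevichZagierPeriods.KontsevichZagierPeriods.Theorems
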